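import Literature.Analysis.FluidPDE.SawtoothCascadeSmooth
import Mathlib.Analysis.Fourier.AddCircle
import Mathlib.Analysis.SpecialFunctions.Gaussian.FourierTransform
import Mathlib.Analysis.SpecialFunctions.Integrals.Basic
import Mathlib.MeasureTheory.Integral.Prod
import Mathlib.MeasureTheory.Integral.IntervalIntegral.Periodic
import Mathlib.MeasureTheory.Integral.IntervalIntegral.IntegrationByParts

/-!
# Fourier coefficients of the rounded-sawtooth shear profile
(route `AnomalousDissipation/SawtoothPulseCascade`; helper for the crux ApproxSol58 =
stmt-AnomalousDissipation-19688, registered stub `stub_responseL2` of the line `linear-response` and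
S1 `stub_responseL2Envelope` of the lead's reshape `linear-response-lip`: the realignment pipeline)

The realigned comb injections of the forced linearised response are read off Fourier coefficient by
coefficient (lead census (i), `TorusHeatFourierMultiplier`).  This file supplies the profile side: the
period-`1` Fourier coefficients `𝓕(g)(m) = ∫₀¹ e^{-2πimy} g(y) dy` (Mathlib `fourierCoeff` of
`AddCircle.liftIco 1 0 g`) of

* the sharp profile `f_N(y) = tri (2πN y)`: supported on the ODD multiples of `N`
  (half-period antisymmetry `tri (θ + π) = -tri θ`), with `|𝓕(f_N)(m)| ≤ 3N²/(π m²)` (piecewise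
  integration by parts);
* (sequel `SawtoothPulseCascadeApproxProfileGaussian`) the rounded profile
  `y ↦ roundedSaw δ (2πN y)`: `𝓕 = exp (−δ²m²/(2N²)) · 𝓕(f_N)(m)`.

Generic glue: the coefficient as `∫₀¹ e^{-2πimy} G(y) dy` over any period, translation, and the
support lemma for half-period antisymmetric `G` (`𝓕(G)(m) = 0` unless `m` is an odd multiple of `N`).
-/

set_option linter.dupNamespace false

noncomputable section

namespace Summit.AnomalousDissipation.AnomalousDissipation.Theorems.SawtoothPulseCascade.ApproxResponse

open Set MeasureTheory Complex intervalIntegral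
open Literature.Analysis Literature.Analysis.FluidPDE
open Literature.Analysis.FluidPDE.SawtoothCascade

/-! ## §1 Half-period antisymmetry of the triangle wave -/

/-- `tri (θ + π) = -tri θ`. -/
theorem tri_add_pi (θ : ℝ) : tri (θ + Real.pi) = -tri θ := by
  unfold tri
  rw [Real.sin_add_pi, Real.arcsin_neg]

/-- The sharp profile `y ↦ tri (2πN y)` is continuous. -/
theorem continuous_tri_mul (N : ℝ) : Continuous fun y : ℝ => tri (2 * Real.pi * N * y) :=
  continuous_tri.comp (continuous_const.mul continuous_id)

/-- The sharp profile `y ↦ tri (2πN y)` is `1`-periodic (`N : ℕ`). -/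
theorem periodic_tri_mul (N : ℕ) : Function.Periodic (fun y : ℝ => tri (2 * Real.pi * N * y)) 1 := by
  intro y
  show tri (2 * Real.pi * N * (y + 1)) = tri (2 * Real.pi * N * y)
  rw [show 2 * Real.pi * N * (y + 1) = 2 * Real.pi * N * y + N * (2 * Real.pi) by ring]
  exact tri_periodic.nat_mul N _

/-- Half-period antisymmetry of the sharp profile: `f_N (y + 1/(2N)) = - f_N y` (`N ≠ 0`). -/
theorem tri_mul_add_half_period {N : ℕ} (hN : N ≠ 0) (y : ℝ) :
    tri (2 * Real.pi * N * (y + 1 / (2 * N))) = -tri (2 * Real.pi * N * y) := by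
  have hN' : (N : ℝ) ≠ 0 := Nat.cast_ne_zero.2 hN
  have h1 : 2 * Real.pi * N * (1 / (2 * N)) = Real.pi := by field_simp
  rw [mul_add, h1]
  exact tri_add_pi _

/-! ## §2 The period-`1` Fourier coefficient as an interval integral -/

/-- The `m`-th period-`1` Fourier coefficient of `G : ℝ → ℂ` (descended by `liftIco`) is
`∫₀¹ e^{-2πimy} G(y) dy`. -/
theorem fourierCoeff_liftIco_eq_integral (G : ℝ → ℂ) (m : ℤ) :
    fourierCoeff (AddCircle.liftIco 1 0 G) m =
      ∫ y in (0 : ℝ)..1, fourier (-m) (y : AddCircle (1 : ℝ)) * G y := by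
  rw [fourierCoeff_eq_intervalIntegral _ m 0, one_div, inv_one, one_smul, zero_add]
  refine integral_congr_Ioo_of_le zero_le_one fun y hy => ?_
  show fourier (-m) (y : AddCircle (1 : ℝ)) • AddCircle.liftIco 1 0 G (y : AddCircle (1 : ℝ)) = _
  rw [AddCircle.liftIco_coe_apply (by rw [zero_add]; exact Ioo_subset_Ico_self hy), smul_eq_mul]

/-- The character in the coefficient integrand: `fourier (-m) y = exp (-2πi m y)`. -/
theorem fourier_neg_coe (m : ℤ) (y : ℝ) :
    fourier (-m) (y : AddCircle (1 : ℝ)) = cexp (-(2 * Real.pi * I * m * y)) := by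
  rw [fourier_coe_apply]
  congr 1
  push_cast
  ring

/-- `‖fourier (-m) y‖ = 1`. -/
theorem norm_fourier_neg_coe (m : ℤ) (y : ℝ) : ‖fourier (-m) (y : AddCircle (1 : ℝ))‖ = 1 := by
  rw [fourier_neg_coe, Complex.norm_exp]
  simp

/-- The coefficient integrand `y ↦ e^{-2πimy} G(y)` of a `1`-periodic `G` is `1`-periodic. -/
theorem periodic_fourier_mul {G : ℝ → ℂ} (hper : Function.Periodic G 1) (m : ℤ) :
    Function.Periodic (fun y : ℝ => fourier (-m) (y : AddCircle (1 : ℝ)) * G y) 1 := by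
  intro y
  show fourier (-m) ((y + 1 : ℝ) : AddCircle (1 : ℝ)) * G (y + 1) = fourier (-m) (y : AddCircle (1 : ℝ)) * G y
  rw [AddCircle.coe_add_period 1 y, hper y]

/-- The coefficient integrand of a continuous `G` is continuous. -/
theorem continuous_fourier_mul {G : ℝ → ℂ} (hG : Continuous G) (m : ℤ) :
    Continuous fun y : ℝ => fourier (-m) (y : AddCircle (1 : ℝ)) * G y :=
  ((fourier (-m)).continuous.comp (AddCircle.continuous_mk' (1 : ℝ))).mul hG

/-- For a `1`-periodic continuous `G` the coefficient integral may be taken over any period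
`[c, c + 1]`. -/
theorem fourierCoeff_liftIco_eq_integral_add {G : ℝ → ℂ} (hper : Function.Periodic G 1) (m : ℤ) (c : ℝ) :
    fourierCoeff (AddCircle.liftIco 1 0 G) m =
      ∫ y in c..c + 1, fourier (-m) (y : AddCircle (1 : ℝ)) * G y := by
  rw [fourierCoeff_liftIco_eq_integral, (periodic_fourier_mul hper m).intervalIntegral_add_eq c 0,
    zero_add]

/-! ## §3 Translation and half-period antisymmetry -/

/-- **Translation**: `∫₀¹ e^{-2πimy} G(y − c) dy = e^{-2πimc} 𝓕(G)(m)` for `1`-periodic `G`. -/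
theorem integral_fourier_mul_comp_sub {G : ℝ → ℂ} (hper : Function.Periodic G 1) (m : ℤ) (c : ℝ) :
    (∫ y in (0 : ℝ)..1, fourier (-m) (y : AddCircle (1 : ℝ)) * G (y - c)) =
      fourier (-m) (c : AddCircle (1 : ℝ)) * fourierCoeff (AddCircle.liftIco 1 0 G) m := by
  set e : ℝ → ℂ := fun y => fourier (-m) (y : AddCircle (1 : ℝ)) with he
  have h1 : (∫ y in (0 : ℝ)..1, e y * G (y - c)) = ∫ y in (0 : ℝ)..1, (fun u : ℝ => e (u + c) * G u) (y - c) := by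
    refine intervalIntegral.integral_congr fun y _ => ?_
    simp only [sub_add_cancel]
  show (∫ y in (0 : ℝ)..1, e y * G (y - c)) = e c * fourierCoeff (AddCircle.liftIco 1 0 G) m
  rw [h1, intervalIntegral.integral_comp_sub_right (fun u : ℝ => e (u + c) * G u) c]
  have h2 : (fun u : ℝ => e (u + c) * G u) = fun u => e c * (e u * G u) := by
    funext u
    simp only [he]
    have hadd : fourier (-m) ((u + c : ℝ) : AddCircle (1 : ℝ)) =
        fourier (-m) (c : AddCircle (1 : ℝ)) * fourier (-m) (u : AddCircle (1 : ℝ)) := by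
      rw [fourier_coe_apply, fourier_coe_apply, fourier_coe_apply, ← Complex.exp_add]
      congr 1
      push_cast
      ring
    rw [hadd]
    ring
  rw [h2, intervalIntegral.integral_const_mul, show (1 : ℝ) - c = 0 - c + 1 by ring,
    ← fourierCoeff_liftIco_eq_integral_add hper m (0 - c)]

/-- **Fourier support of a half-period antisymmetric function.** If `G` is `1`-periodic with
`G (y + 1/(2N)) = -G y` (`N ≠ 0`), then `𝓕(G)(m) = 0` unless `m` is an odd multiple of `N`. -/
theorem fourierCoeff_eq_zero_of_half_period {G : ℝ → ℂ} (hper : Function.Periodic G 1)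
    {N : ℕ} (hN : N ≠ 0) (hanti : ∀ y, G (y + 1 / (2 * N)) = -G y) {m : ℤ}
    (hm : ¬ ∃ n : ℤ, m = (2 * n + 1) * (N : ℤ)) :
    fourierCoeff (AddCircle.liftIco 1 0 G) m = 0 := by
  set I₀ := fourierCoeff (AddCircle.liftIco 1 0 G) m with hI₀
  have hN' : (N : ℝ) ≠ 0 := Nat.cast_ne_zero.2 hN
  -- translate by `c = -1/(2N)`
  have h := integral_fourier_mul_comp_sub hper m (-(1 / (2 * N)))
  have hL : (∫ y in (0 : ℝ)..1, fourier (-m) (y : AddCircle (1 : ℝ)) * G (y - -(1 / (2 * N)))) = -I₀ := by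
    rw [hI₀, fourierCoeff_liftIco_eq_integral, ← intervalIntegral.integral_neg]
    refine intervalIntegral.integral_congr fun y _ => ?_
    simp only [sub_neg_eq_add, hanti y, mul_neg]
  rw [hL] at h
  -- `-I₀ = e^{iπ m/N} I₀`
  by_contra hne
  have hE : fourier (-m) ((-(1 / (2 * N)) : ℝ) : AddCircle (1 : ℝ)) = -1 := by
    have h' : (fourier (-m) ((-(1 / (2 * N)) : ℝ) : AddCircle (1 : ℝ)) + 1) * I₀ = 0 := by
      rw [add_mul, one_mul, ← h, neg_add_cancel]
    rcases mul_eq_zero.1 h' with h1 | h1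
    · exact eq_neg_of_add_eq_zero_left h1
    · exact absurd h1 hne
  rw [fourier_neg_coe] at hE
  have hx : cexp (-(2 * Real.pi * I * m * ((-(1 / (2 * N)) : ℝ) : ℂ))) = cexp (Real.pi * I) := by
    rw [hE, Complex.exp_pi_mul_I]
  obtain ⟨n, hn⟩ := Complex.exp_eq_exp_iff_exists_int.1 hx
  apply hm
  refine ⟨n, ?_⟩
  have hπ : (Real.pi : ℂ) * I ≠ 0 := mul_ne_zero (by exact_mod_cast Real.pi_ne_zero) I_ne_zero
  have hNc : (N : ℂ) ≠ 0 := by exact_mod_cast hN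
  have key : ((m : ℤ) : ℂ) = (2 * n + 1) * (N : ℂ) := by
    have e1 : -(2 * Real.pi * I * m * ((-(1 / (2 * N)) : ℝ) : ℂ)) = (Real.pi * I) * (m / N) := by
      push_cast
      ring
    rw [e1] at hn
    have e2 : (Real.pi : ℂ) * I * ((m : ℂ) / N) = Real.pi * I * (1 + n * 2) := by
      rw [hn]; ring
    have e3 : (m : ℂ) / N = 1 + n * 2 := mul_left_cancel₀ hπ e2
    rw [div_eq_iff hNc] at e3
    rw [e3]; ring
  exact_mod_cast key


/-! ## §4 The sharp profile: scaling to `N = 1` and the `1/m²` coefficient bound -/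

/-- **Scaling**: the `nN`-th coefficient of `y ↦ tri (2πN y)` is the `n`-th coefficient of
`u ↦ tri (2π u)` (substitute `u = N y` and use `1`-periodicity over the `N` periods). -/
theorem fourierCoeff_tri_mul_scaling {N : ℕ} (hN : N ≠ 0) (n : ℤ) :
    fourierCoeff (AddCircle.liftIco 1 0 fun y : ℝ => (tri (2 * Real.pi * N * y) : ℂ)) (n * N) =
      fourierCoeff (AddCircle.liftIco 1 0 fun u : ℝ => (tri (2 * Real.pi * u) : ℂ)) n := by
  have hN' : (N : ℝ) ≠ 0 := Nat.cast_ne_zero.2 hN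
  set g : ℝ → ℂ := fun u => fourier (-n) (u : AddCircle (1 : ℝ)) * (tri (2 * Real.pi * u) : ℂ) with hg
  have hgc : Continuous g := continuous_fourier_mul (Complex.continuous_ofReal.comp
    (continuous_tri.comp (continuous_const.mul continuous_id))) n
  have hgper : Function.Periodic g 1 := by
    have h1 : Function.Periodic (fun u : ℝ => (tri (2 * Real.pi * u) : ℂ)) 1 := by
      intro u
      show (tri (2 * Real.pi * (u + 1)) : ℂ) = (tri (2 * Real.pi * u) : ℂ)
      rw [show 2 * Real.pi * (u + 1) = 2 * Real.pi * u + 2 * Real.pi by ring, tri_periodic]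
    exact periodic_fourier_mul h1 n
  rw [fourierCoeff_liftIco_eq_integral, fourierCoeff_liftIco_eq_integral]
  -- the integrand on the left is `g (N y)`
  have hint : (∫ y in (0 : ℝ)..1, fourier (-(n * N)) (y : AddCircle (1 : ℝ)) * (tri (2 * Real.pi * N * y) : ℂ)) =
      ∫ y in (0 : ℝ)..1, g (N * y) := by
    refine intervalIntegral.integral_congr fun y _ => ?_
    simp only [hg]
    rw [fourier_neg_coe, fourier_neg_coe]
    congr 1
    · congr 1
      push_cast
      ring
    · congr 2
      ring
  rw [hint, intervalIntegral.integral_comp_mul_left g hN', mul_zero, mul_one]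
  have hper : (∫ x in (0 : ℝ)..(N : ℝ), g x) = (N : ℤ) • ∫ x in (0 : ℝ)..1, g x := by
    have h := hgper.intervalIntegral_add_zsmul_eq (N : ℤ) 0 fun t₁ t₂ => hgc.intervalIntegrable t₁ t₂
    simpa using h
  rw [hper, zsmul_eq_mul, Complex.real_smul]
  push_cast
  field_simp
  rfl

/-- A linear piece: `∫_a^b e^{cy} (α y + β) dy` in closed form (integration by parts). -/
theorem integral_cexp_mul_linear {c : ℂ} (hc : c ≠ 0) (α β : ℂ) (a b : ℝ) :
    (∫ y in a..b, cexp (c * y) * (α * y + β)) =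
      ((α * b + β) * cexp (c * b) - (α * a + β) * cexp (c * a)) / c -
        α * (cexp (c * b) - cexp (c * a)) / c ^ 2 := by
  have hu : ∀ y ∈ uIcc a b, HasDerivAt (fun y : ℝ => α * (y : ℂ) + β) α y := by
    intro y _
    have h1 : HasDerivAt (fun y : ℝ => (y : ℂ)) 1 y := (hasDerivAt_id y).ofReal_comp
    simpa using (h1.const_mul α).add_const β
  have hv : ∀ y ∈ uIcc a b, HasDerivAt (fun y : ℝ => cexp (c * y) / c) (cexp (c * y)) y := by
    intro y _
    have h1 : HasDerivAt (fun y : ℝ => c * (y : ℂ)) c y := by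
      simpa using ((hasDerivAt_id y).ofReal_comp).const_mul c
    have h2 := (Complex.hasDerivAt_exp (c * y)).comp y h1
    have h3 := h2.div_const c
    rwa [mul_div_assoc, div_self hc, mul_one] at h3
  have hib := intervalIntegral.integral_mul_deriv_eq_deriv_mul hu hv
    (continuous_const.intervalIntegrable a b)
    ((Complex.continuous_exp.comp (continuous_const.mul Complex.continuous_ofReal)).intervalIntegrable a b)
  have hcomm : (∫ y in a..b, cexp (c * y) * (α * y + β)) = ∫ y in a..b, (α * y + β) * cexp (c * y) := by
    refine intervalIntegral.integral_congr fun y _ => ?_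
    ring
  rw [hcomm, hib]
  have hI : (∫ y in a..b, α * (cexp (c * y) / c)) = α * ((cexp (c * b) - cexp (c * a)) / c) / c := by
    rw [show (fun y : ℝ => α * (cexp (c * y) / c)) = fun y : ℝ => (α / c) * cexp (c * y) by
      funext y; field_simp, intervalIntegral.integral_const_mul, integral_exp_mul_complex hc]
    field_simp
  rw [hI]
  field_simp

/-- The three linear branches of `u ↦ tri (2π u)` on `[0, 1]`. -/
theorem tri_two_pi_mul_of_mem_first {u : ℝ} (hu : u ∈ Icc (0 : ℝ) (1 / 4)) :
    tri (2 * Real.pi * u) = 2 * Real.pi * u :=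
  tri_eq_self (by nlinarith [Real.pi_pos, hu.1]) (by nlinarith [Real.pi_pos, hu.2])

/-- Descending branch on `[1/4, 3/4]`. -/
theorem tri_two_pi_mul_of_mem_second {u : ℝ} (hu : u ∈ Icc (1 / 4 : ℝ) (3 / 4)) :
    tri (2 * Real.pi * u) = Real.pi - 2 * Real.pi * u :=
  tri_eq_pi_sub (by nlinarith [Real.pi_pos, hu.1]) (by nlinarith [Real.pi_pos, hu.2])

/-- Ascending branch on `[3/4, 1]`. -/
theorem tri_two_pi_mul_of_mem_third {u : ℝ} (hu : u ∈ Icc (3 / 4 : ℝ) 1) :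
    tri (2 * Real.pi * u) = 2 * Real.pi * u - 2 * Real.pi := by
  have h := tri_periodic (2 * Real.pi * u - 2 * Real.pi)
  rw [sub_add_cancel] at h; rw [h]
  have hπ := Real.pi_pos
  refine tri_eq_self ?_ ?_
  · nlinarith [hu.1, mul_nonneg (sub_nonneg.2 hu.1) hπ.le]
  · nlinarith [hu.2, mul_nonneg (sub_nonneg.2 hu.2) hπ.le]

/-- **Coefficient bound for the unit sharp profile**: `‖𝓕(u ↦ tri 2πu)(n)‖ ≤ 3/(π n²)` for `n ≠ 0`
(integration by parts on the three linear branches; the boundary terms telescope to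
`tri 2π − tri 0 = 0`, the slopes `±2π` leave `Σ |slope|·2/(2πn)² = 3/(πn²)`). -/
theorem norm_fourierCoeff_tri_two_pi_le {n : ℤ} (hn : n ≠ 0) :
    ‖fourierCoeff (AddCircle.liftIco 1 0 fun u : ℝ => (tri (2 * Real.pi * u) : ℂ)) n‖ ≤
      3 / (Real.pi * n ^ 2) := by
  set c : ℂ := -(2 * Real.pi * I * n) with hc_def
  have hπ : (0 : ℝ) < Real.pi := Real.pi_pos
  have hc : c ≠ 0 := by
    rw [hc_def, neg_ne_zero]
    exact mul_ne_zero (mul_ne_zero (mul_ne_zero two_ne_zero (by exact_mod_cast hπ.ne')) I_ne_zero)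
      (by exact_mod_cast hn)
  have hnormc : ‖c‖ = 2 * Real.pi * |(n : ℝ)| := by
    rw [hc_def, norm_neg, norm_mul, norm_mul, norm_mul, Complex.norm_I, mul_one, Complex.norm_two,
      Complex.norm_real, Real.norm_of_nonneg hπ.le, Complex.norm_intCast]
  -- the coefficient as `∫₀¹ e^{cy} tri(2πy) dy`
  have hF : fourierCoeff (AddCircle.liftIco 1 0 fun u : ℝ => (tri (2 * Real.pi * u) : ℂ)) n =
      ∫ y in (0 : ℝ)..1, cexp (c * y) * (tri (2 * Real.pi * y) : ℂ) := by
    rw [fourierCoeff_liftIco_eq_integral]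
    refine intervalIntegral.integral_congr fun y _ => ?_
    rw [fourier_neg_coe, hc_def]
    congr 2
    ring
  have hcont : Continuous fun y : ℝ => cexp (c * y) * (tri (2 * Real.pi * y) : ℂ) :=
    (Complex.continuous_exp.comp (continuous_const.mul Complex.continuous_ofReal)).mul
      (Complex.continuous_ofReal.comp (continuous_tri.comp (continuous_const.mul continuous_id)))
  have hii : ∀ p q : ℝ, IntervalIntegrable (fun y : ℝ => cexp (c * y) * (tri (2 * Real.pi * y) : ℂ))
      volume p q := fun p q => hcont.intervalIntegrable p q
  -- split at `1/4` and `3/4`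
  have hsplit : (∫ y in (0 : ℝ)..1, cexp (c * y) * (tri (2 * Real.pi * y) : ℂ)) =
      (∫ y in (0 : ℝ)..(1 / 4), cexp (c * y) * (tri (2 * Real.pi * y) : ℂ)) +
      (∫ y in (1 / 4 : ℝ)..(3 / 4), cexp (c * y) * (tri (2 * Real.pi * y) : ℂ)) +
      (∫ y in (3 / 4 : ℝ)..1, cexp (c * y) * (tri (2 * Real.pi * y) : ℂ)) := by
    rw [intervalIntegral.integral_add_adjacent_intervals (hii _ _) (hii _ _),
      intervalIntegral.integral_add_adjacent_intervals (hii _ _) (hii _ _)]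
  -- evaluate each piece
  have h1 : (∫ y in (0 : ℝ)..(1 / 4), cexp (c * y) * (tri (2 * Real.pi * y) : ℂ)) =
      ∫ y in (0 : ℝ)..(1 / 4), cexp (c * y) * ((2 * Real.pi : ℂ) * y + 0) := by
    refine intervalIntegral.integral_congr fun y hy => ?_
    rw [uIcc_of_le (by norm_num)] at hy
    simp only [tri_two_pi_mul_of_mem_first hy, add_zero]
    push_cast; ring
  have h2 : (∫ y in (1 / 4 : ℝ)..(3 / 4), cexp (c * y) * (tri (2 * Real.pi * y) : ℂ)) =
      ∫ y in (1 / 4 : ℝ)..(3 / 4), cexp (c * y) * (-(2 * Real.pi : ℂ) * y + Real.pi) := by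
    refine intervalIntegral.integral_congr fun y hy => ?_
    rw [uIcc_of_le (by norm_num)] at hy
    simp only [tri_two_pi_mul_of_mem_second hy]
    push_cast; ring
  have h3 : (∫ y in (3 / 4 : ℝ)..1, cexp (c * y) * (tri (2 * Real.pi * y) : ℂ)) =
      ∫ y in (3 / 4 : ℝ)..1, cexp (c * y) * ((2 * Real.pi : ℂ) * y + -(2 * Real.pi)) := by
    refine intervalIntegral.integral_congr fun y hy => ?_
    rw [uIcc_of_le (by norm_num)] at hy
    simp only [tri_two_pi_mul_of_mem_third hy]
    push_cast; ring
  rw [hF, hsplit, h1, h2, h3, integral_cexp_mul_linear hc, integral_cexp_mul_linear hc,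
    integral_cexp_mul_linear hc]
  -- the boundary terms telescope; what is left is `-(2π/c²)·(Σ ± (e(b) − e(a)))`
  have key : ((2 * ↑Real.pi * ↑(1 / 4 : ℝ) + 0) * cexp (c * ↑(1 / 4 : ℝ)) -
          (2 * ↑Real.pi * ↑(0 : ℝ) + 0) * cexp (c * ↑(0 : ℝ))) / c -
        2 * ↑Real.pi * (cexp (c * ↑(1 / 4 : ℝ)) - cexp (c * ↑(0 : ℝ))) / c ^ 2 +
      (((-(2 * ↑Real.pi) * ↑(3 / 4 : ℝ) + ↑Real.pi) * cexp (c * ↑(3 / 4 : ℝ)) -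
          (-(2 * ↑Real.pi) * ↑(1 / 4 : ℝ) + ↑Real.pi) * cexp (c * ↑(1 / 4 : ℝ))) / c -
        -(2 * ↑Real.pi) * (cexp (c * ↑(3 / 4 : ℝ)) - cexp (c * ↑(1 / 4 : ℝ))) / c ^ 2) +
      (((2 * ↑Real.pi * ↑(1 : ℝ) + -(2 * ↑Real.pi)) * cexp (c * ↑(1 : ℝ)) -
          (2 * ↑Real.pi * ↑(3 / 4 : ℝ) + -(2 * ↑Real.pi)) * cexp (c * ↑(3 / 4 : ℝ))) / c -
        2 * ↑Real.pi * (cexp (c * ↑(1 : ℝ)) - cexp (c * ↑(3 / 4 : ℝ))) / c ^ 2) =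
      -(2 * ↑Real.pi) / c ^ 2 *
        ((cexp (c * ↑(1 / 4 : ℝ)) - cexp (c * ↑(0 : ℝ))) - (cexp (c * ↑(3 / 4 : ℝ)) - cexp (c * ↑(1 / 4 : ℝ)))
          + (cexp (c * ↑(1 : ℝ)) - cexp (c * ↑(3 / 4 : ℝ)))) := by
    push_cast
    field_simp
    ring
  rw [key, norm_mul, norm_div, norm_neg, norm_pow, hnormc]
  have hE : ∀ y : ℝ, ‖cexp (c * y)‖ = 1 := by
    intro y
    rw [Complex.norm_exp, hc_def]
    simp
  have hT : ‖(cexp (c * ↑(1 / 4 : ℝ)) - cexp (c * ↑(0 : ℝ))) - (cexp (c * ↑(3 / 4 : ℝ)) - cexp (c * ↑(1 / 4 : ℝ)))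
      + (cexp (c * ↑(1 : ℝ)) - cexp (c * ↑(3 / 4 : ℝ)))‖ ≤ 6 := by
    refine (norm_add_le _ _).trans ?_
    refine (add_le_add (norm_sub_le _ _) le_rfl).trans ?_
    have a1 := norm_sub_le (cexp (c * ↑(1 / 4 : ℝ))) (cexp (c * ↑(0 : ℝ)))
    have a2 := norm_sub_le (cexp (c * ↑(3 / 4 : ℝ))) (cexp (c * ↑(1 / 4 : ℝ)))
    have a3 := norm_sub_le (cexp (c * ↑(1 : ℝ))) (cexp (c * ↑(3 / 4 : ℝ)))
    rw [hE, hE] at a1 a2 a3; linarith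
  have hn1 : (1 : ℝ) ≤ |(n : ℝ)| := by
    rw [← Int.cast_abs]; exact_mod_cast Int.one_le_abs hn
  have h2π : ‖(2 * Real.pi : ℂ)‖ = 2 * Real.pi := by
    rw [show (2 * Real.pi : ℂ) = ((2 * Real.pi : ℝ) : ℂ) by push_cast; ring, Complex.norm_real,
      Real.norm_of_nonneg (by positivity)]
  rw [h2π]
  calc 2 * Real.pi / (2 * Real.pi * |(n : ℝ)|) ^ 2 * ‖(cexp (c * ↑(1 / 4 : ℝ)) - cexp (c * ↑(0 : ℝ))) -
        (cexp (c * ↑(3 / 4 : ℝ)) - cexp (c * ↑(1 / 4 : ℝ))) + (cexp (c * ↑(1 : ℝ)) - cexp (c * ↑(3 / 4 : ℝ)))‖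
      ≤ 2 * Real.pi / (2 * Real.pi * |(n : ℝ)|) ^ 2 * 6 := by gcongr
    _ = 3 / (Real.pi * n ^ 2) := by
      rw [mul_pow, sq_abs]
      field_simp
      ring


/-- **The sharp profile is Fourier-supported on the odd multiples of `N`.** -/
theorem fourierCoeff_tri_mul_eq_zero {N : ℕ} (hN : N ≠ 0) {m : ℤ}
    (hm : ¬ ∃ n : ℤ, m = (2 * n + 1) * (N : ℤ)) :
    fourierCoeff (AddCircle.liftIco 1 0 fun y : ℝ => (tri (2 * Real.pi * N * y) : ℂ)) m = 0 :=
  fourierCoeff_eq_zero_of_half_period (G := fun y : ℝ => (tri (2 * Real.pi * N * y) : ℂ))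
    (fun y => by simp only [periodic_tri_mul N y]) hN
    (fun y => by simp only [tri_mul_add_half_period hN y, Complex.ofReal_neg]) hm

/-- **Coefficient bound for the sharp profile of frequency `N`**: `‖𝓕(f_N)(m)‖ ≤ 3N²/(π m²)` for
`m ≠ 0` (zero off the odd multiples of `N`; on them, scaling to `N = 1`). -/
theorem norm_fourierCoeff_tri_mul_le {N : ℕ} (hN : N ≠ 0) {m : ℤ} (hm : m ≠ 0) :
    ‖fourierCoeff (AddCircle.liftIco 1 0 fun y : ℝ => (tri (2 * Real.pi * N * y) : ℂ)) m‖ ≤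
      3 * (N : ℝ) ^ 2 / (Real.pi * (m : ℝ) ^ 2) := by
  have hπ := Real.pi_pos
  by_cases hodd : ∃ n : ℤ, m = (2 * n + 1) * (N : ℤ)
  · obtain ⟨n, rfl⟩ := hodd
    have hn0 : (2 * n + 1 : ℤ) ≠ 0 := by omega
    rw [fourierCoeff_tri_mul_scaling hN (2 * n + 1)]
    refine (norm_fourierCoeff_tri_two_pi_le hn0).trans (le_of_eq ?_)
    have hN' : (N : ℝ) ≠ 0 := Nat.cast_ne_zero.2 hN
    have hn' : ((2 * n + 1 : ℤ) : ℝ) ≠ 0 := by exact_mod_cast hn0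
    push_cast
    field_simp
  · rw [fourierCoeff_tri_mul_eq_zero hN hodd, norm_zero]
    positivity

end Summit.AnomalousDissipation.AnomalousDissipation.Theorems.SawtoothPulseCascade.ApproxResponse

end
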